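import Mathlib
import HarnessLib
import Literature.Analysis.FluidPDE.SelfSimilar
import Literature.Analysis.FluidPDE.ClassicalSolution
import Literature.Analysis.FluidPDE.ClassicalSolutionCalculus
import Literature.Analysis.FluidPDE.Vorticity
import Literature.Analysis.FluidPDE.VectorCalculus
import Literature.Analysis.FluidPDE.VorticityCalculus
import Literature.Analysis.FluidPDE.TaoEnstrophyLocalisation
import Literature.Analysis.FluidPDE.IsometryInvariance
import Literature.Analysis.FluidPDE.CurlIsometryCovariance
import Literature.Analysis.FluidPDE.MildSolutionIsometryCovariance
import Literature.Analysis.FluidPDE.KatoSymmetryCovariance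
import Literature.Analysis.FluidPDE.AxisymmetricEuler
import Literature.Analysis.FluidPDE.SwirlTransportProofs
import Literature.Analysis.FluidPDE.AxisymmetricVorticityTransport
import Literature.Analysis.FluidPDE.AxisymmetricReflection
import Literature.Analysis.FluidPDE.AxisymNoSwirlVorticity
import Summits.NavierStokesRegularity.NavierStokesRegularity.Theorems.UnthreadedDoorNetFluxDefs
import Summits.NavierStokesRegularity.NavierStokesRegularity.Theorems.UnthreadedDoorVorticityOfClass
import Summits.NavierStokesRegularity.NavierStokesRegularity.Theorems.UnthreadedDoorCellFluxZDefs
import Summits.NavierStokesRegularity.NavierStokesRegularity.Theorems.UnthreadedDoorCellFluxAxisFrozenStatics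

/-!
# Route `UnthreadedDoor`, crux `PoloidalLiouville` (stmt-NavierStokesRegularity-1222), WALL W1 — cell-flux Z skeleton, stub Z-1b `AxisFrozen`:
# the PER-TIME FRAME PACKAGE (`Cruxes/PoloidalLiouville/CellFluxZSkeleton.lean` v1.1 c6ae0be7f8d8; custodian ns-idea-14, critic V22)

For a bounded ancient mild solution `v` (duality class, `ν = 1`), smooth on the slab, UNTHREADED about `x₀`, and a time `t < 0` at which `v t − c` is
axisymmetric without swirl in a frame `R` (axis direction `e := R⁻¹ e_z`): STATIC facts (`ω(t,·) ⊥ e`; uniqueness of the zonal direction; 90°-partners;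
spanning by two vorticity vectors; `v t x₀ − c ∥ e`) and the DYNAMIC facts `frame_dynamic`: `∂ₜω(t,·) ⊥ e` and `ω(t,·) ⊥ c`.  Proof of the latter:
conjugate the solution by the FIXED Euclidean frame (`V s := conjAxis R x₀ (v s)`, again in the class, hence a vorticity solution by
`Theorems.PoloidalLiouville.isVorticitySolutionOn_Iio`); at time `t`, `V t = W + Rc` with `W` axisymmetric swirl-free, so `∂ₜω_V = N(W) − Dω_W·(Rc)`
(`vortN_add_const`) with `N(W)` AZIMUTHAL (`vortN_azimuthal`); unthreadedness at all times gives `⟪y, ∂ₜω_V⟫ = 0`; transport back by the pseudovector law.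
WHAT THIS IS NOT: support lemmas for one stub of Z; `PoloidalLiouville` (1222), Z, W1 and NS regularity stay OPEN.  `--supports 1222 --as helper`. [folklore]
-/


noncomputable section

-- the summit and its single sub-problem share the name (CONVENTIONS §1)
set_option linter.dupNamespace false

open Set Function Filter Topology MeasureTheory Metric InnerProductSpace
open scoped RealInnerProductSpace Laplacian InnerProductSpace

namespace Summit.NavierStokesRegularity.NavierStokesRegularity.Theorems.PoloidalLiouville.CellFlux

open Summit.NavierStokesRegularity.NavierStokesRegularity.Theorems.PoloidalLiouville.NetFlux (E3)
open Literature.Analysis Literature.Analysis.FluidPDE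

/-! ### §0 Small calculus facts -/

/-- `a × b ⟂ b` (coordinates). -/
private theorem inner_cross_self_right' (a b : E3) : ⟪cross a b, b⟫ = 0 := by
  simp only [cross, PiLp.inner_apply, cross_apply, RCLike.inner_apply, conj_trivial,
    Fin.sum_univ_three, Matrix.cons_val_zero, Matrix.cons_val_one, Matrix.cons_val_two,
    Matrix.head_cons, Matrix.tail_cons]
  ring

/-- If `ω₂ ≡ 0` then every directional derivative of `ω` has vanishing third component. [folklore] -/
theorem fderiv_apply_two_eq_zero {ω : E3 → E3} (hd : Differentiable ℝ ω) (hz : ∀ y, ω y 2 = 0) (y h : E3) :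
    fderiv ℝ ω y h 2 = 0 := by
  have hD : HasFDerivAt ((EuclideanSpace.proj (2 : Fin 3) : E3 →L[ℝ] ℝ) ∘ ω)
      ((EuclideanSpace.proj (2 : Fin 3) : E3 →L[ℝ] ℝ).comp (fderiv ℝ ω y)) y :=
    (EuclideanSpace.proj (2 : Fin 3) : E3 →L[ℝ] ℝ).hasFDerivAt.comp y (hd y).hasFDerivAt
  have hzero : ((EuclideanSpace.proj (2 : Fin 3) : E3 →L[ℝ] ℝ) ∘ ω) = fun _ => (0 : ℝ) := funext fun y => hz y
  have hD0 : HasFDerivAt ((EuclideanSpace.proj (2 : Fin 3) : E3 →L[ℝ] ℝ) ∘ ω) (0 : E3 →L[ℝ] ℝ) y := by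
    rw [hzero]
    exact hasFDerivAt_const (0 : ℝ) y
  have := congrArg (fun L : E3 →L[ℝ] ℝ => L h) (hD.unique hD0)
  simpa using this

/-- If `⟪y, ω(y)⟫ ≡ 0` then `⟪y, Dω(y) h⟫ = −⟪h, ω(y)⟫`. [folklore] -/
theorem inner_fderiv_apply_eq_neg {ω : E3 → E3} (hd : Differentiable ℝ ω) (hperp : ∀ y, ⟪y, ω y⟫ = 0) (y h : E3) :
    ⟪y, fderiv ℝ ω y h⟫ = -⟪h, ω y⟫ := by
  have hzero : (fun z : E3 => ⟪z, ω z⟫) = fun _ => (0 : ℝ) := funext fun z => hperp z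
  have hfd : fderiv ℝ (fun z : E3 => ⟪z, ω z⟫) y h = 0 := by
    rw [hzero]
    simp
  have hid : DifferentiableAt ℝ (fun z : E3 => z) y := differentiableAt_fun_id
  rw [fderiv_inner_apply ℝ hid (hd y), fderiv_fun_id, ContinuousLinearMap.id_apply] at hfd
  linarith

/-! ### §1 The conjugated field and its vorticity -/

/-- **Pseudovector law for `conjAxis`**: `curl (conjAxis R p u)(y) = det R • R (curl u (R⁻¹ y + p))`. [folklore] -/
theorem curl_conjAxis (R : E3 ≃ₗᵢ[ℝ] E3) (p : E3) (u : E3 → E3) (y : E3) :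
    curl (conjAxis R p u) y = (R : E3 →L[ℝ] E3).det • R (curl u (R.symm y + p)) := by
  have h2 : curl (fun z => u (z + p)) (R.symm y) = curl u (R.symm y + p) := by
    rw [curl_eq_curlCLM, curl_eq_curlCLM, fderiv_comp_add_right]
  have key := curl_conj_linearIsometryEquiv R (fun z => u (z + p)) y
  rw [h2] at key
  exact key

/-- Subtracting a constant before conjugating does not change the curl. [folklore] -/
theorem curl_conjAxis_sub_const (R : E3 ≃ₗᵢ[ℝ] E3) (p : E3) (u : E3 → E3) (c y : E3) :
    curl (conjAxis R p fun z => u z - c) y = (R : E3 →L[ℝ] E3).det • R (curl u (R.symm y + p)) := by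
  rw [curl_conjAxis]
  congr 2
  rw [curl_eq_curlCLM, curl_eq_curlCLM, fderiv_sub_const]

/-- `det R = ±1`, in the form `det R ≠ 0`. [folklore] -/
theorem det_ne_zero (R : E3 ≃ₗᵢ[ℝ] E3) : (R : E3 →L[ℝ] E3).det ≠ 0 := by
  rcases det_linearIsometryEquiv_eq_one_or_eq_neg_one R with h | h <;> rw [h] <;> norm_num

/-! ### §2 Static consequences of one swirl-free frame -/

section Static

variable {u : E3 → E3} {R : E3 ≃ₗᵢ[ℝ] E3} {p c : E3}

/-- The conjugated, re-centred slice `W := conjAxis R p (u − c)` is `C^n` when `u` is. -/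
theorem contDiff_conjAxis {n : ℕ∞} (hu : ContDiff ℝ n u) (R : E3 ≃ₗᵢ[ℝ] E3) (p c : E3) :
    ContDiff ℝ n (conjAxis R p fun z => u z - c) :=
  R.contDiff.comp ((hu.sub contDiff_const).comp ((R.symm.contDiff).add contDiff_const))

/-- **`ω ⊥ e`**: the vorticity of `u` is orthogonal to the axis direction `e = R⁻¹ e_z` of a swirl-free frame. [folklore] -/
theorem inner_dir_curl_eq_zero (hu : ContDiff ℝ 1 u) (hax : IsAxisymmetric (conjAxis R p fun z => u z - c))
    (hsw : HasNoSwirl (conjAxis R p fun z => u z - c)) (x : E3) :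
    ⟪R.symm (EuclideanSpace.single 2 (1 : ℝ)), curl u x⟫ = 0 := by
  have hW1 : ContDiff ℝ 1 (conjAxis R p fun z => u z - c) := contDiff_conjAxis hu R p c
  have h := curl_apply_two_eq_zero hax hsw hW1 (R (x - p))
  rw [curl_conjAxis_sub_const, LinearIsometryEquiv.symm_apply_apply, sub_add_cancel, PiLp.smul_apply, smul_eq_mul] at h
  have h' : R (curl u x) 2 = 0 := (mul_eq_zero.1 h).resolve_left (det_ne_zero R)
  have h'' : ⟪R (curl u x), EuclideanSpace.single 2 (1 : ℝ)⟫ = 0 := by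
    rw [EuclideanSpace.inner_single_right, h']
    simp
  rwa [← LinearIsometryEquiv.inner_map_map R, LinearIsometryEquiv.apply_symm_apply, real_inner_comm]

/-- **Uniqueness of the zonal direction**: if `curl u ≢ 0`, every vector orthogonal to all of `curl u` is a multiple of `e = R⁻¹ e_z`. [folklore] -/
theorem exists_smul_dir_of_forall_inner_curl (hu : ContDiff ℝ 1 u) (hax : IsAxisymmetric (conjAxis R p fun z => u z - c))
    (hsw : HasNoSwirl (conjAxis R p fun z => u z - c)) {x₁ : E3} (hx₁ : curl u x₁ ≠ 0)
    {d : E3} (hd : ∀ x, ⟪d, curl u x⟫ = 0) : ∃ μ : ℝ, d = μ • R.symm (EuclideanSpace.single 2 (1 : ℝ)) := by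
  set W : E3 → E3 := conjAxis R p fun z => u z - c with hW
  have hW1 : ContDiff ℝ 1 W := contDiff_conjAxis hu R p c
  have hWcurl : ∀ y, curl W y = (R : E3 →L[ℝ] E3).det • R (curl u (R.symm y + p)) := fun y => curl_conjAxis_sub_const R p u c y
  have hy₁ : curl W (R (x₁ - p)) ≠ 0 := by
    rw [hWcurl, LinearIsometryEquiv.symm_apply_apply, sub_add_cancel]
    intro h0
    rcases smul_eq_zero.1 h0 with h1 | h1
    · exact det_ne_zero R h1
    · exact hx₁ (by simpa using congrArg R.symm h1)
  have hd' : ∀ y, ⟪R d, curl W y⟫ = 0 := fun y => by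
    rw [hWcurl, inner_smul_right, LinearIsometryEquiv.inner_map_map, hd, mul_zero]
  obtain ⟨h0, h1⟩ := horizontal_eq_zero_of_forall_inner_curl hax hsw hW1 hy₁ hd'
  set w : E3 := R d with hw
  refine ⟨w 2, ?_⟩
  have hRd : w = (w 2) • EuclideanSpace.single 2 (1 : ℝ) := by
    ext i
    fin_cases i <;> simp [h0, h1]
  have hback : d = R.symm w := by rw [hw, R.symm_apply_apply]
  rw [hback]
  conv_lhs => rw [hRd]
  rw [map_smul]

/-- **The 90°-partner**: for every point there is another whose vorticity vector has the same length and is orthogonal to the first. [folklore] -/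
theorem exists_orthogonal_partner (hu : ContDiff ℝ 1 u) (hax : IsAxisymmetric (conjAxis R p fun z => u z - c))
    (hsw : HasNoSwirl (conjAxis R p fun z => u z - c)) (x₁ : E3) :
    ∃ x₂ : E3, ‖curl u x₂‖ = ‖curl u x₁‖ ∧ ⟪curl u x₁, curl u x₂⟫ = 0 := by
  set W : E3 → E3 := conjAxis R p fun z => u z - c with hW
  have hW1 : ContDiff ℝ 1 W := contDiff_conjAxis hu R p c
  have hWd : Differentiable ℝ W := hW1.differentiable one_ne_zero
  have hWcurl : ∀ y, curl W y = (R : E3 →L[ℝ] E3).det • R (curl u (R.symm y + p)) := fun y => curl_conjAxis_sub_const R p u c y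
  set y₁ : E3 := R (x₁ - p) with hy₁
  set x₂ : E3 := R.symm (rotZ (Real.pi / 2) y₁) + p with hx₂
  refine ⟨x₂, ?_⟩
  -- in the frame: `curl W (R_{π/2} y₁) = R_{π/2} (curl W y₁)`
  have hrot : curl W (rotZ (Real.pi / 2) y₁) = rotZ (Real.pi / 2) (curl W y₁) := (hax.curl hWd) (Real.pi / 2) y₁
  set a : E3 := R (curl u x₁) with ha
  set b : E3 := R (curl u x₂) with hb
  have hWy₁ : curl W y₁ = (R : E3 →L[ℝ] E3).det • a := by
    rw [hWcurl, hy₁, LinearIsometryEquiv.symm_apply_apply, sub_add_cancel]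
  have hWy₂ : curl W (rotZ (Real.pi / 2) y₁) = (R : E3 →L[ℝ] E3).det • b := by
    rw [hWcurl, hb, hx₂]
  have hab : b = rotZ (Real.pi / 2) a := by
    have h := hrot
    rw [hWy₁, hWy₂, ← rotZL_apply, map_smul, rotZL_apply] at h
    exact smul_right_injective E3 (det_ne_zero R) h
  have ha2 : a 2 = 0 := by
    have h := curl_apply_two_eq_zero hax hsw hW1 y₁
    rw [hWy₁, PiLp.smul_apply, smul_eq_mul] at h
    exact (mul_eq_zero.1 h).resolve_left (det_ne_zero R)
  have hna : ‖curl u x₁‖ = ‖a‖ := by rw [ha, LinearIsometryEquiv.norm_map]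
  have hnb : ‖curl u x₂‖ = ‖b‖ := by rw [hb, LinearIsometryEquiv.norm_map]
  have hinner : ⟪curl u x₁, curl u x₂⟫ = ⟪a, b⟫ := by rw [ha, hb, LinearIsometryEquiv.inner_map_map]
  constructor
  · rw [hna, hnb, hab, norm_rotZ]
  · rw [hinner, hab]
    simp only [PiLp.inner_apply, RCLike.inner_apply, conj_trivial, Fin.sum_univ_three, rotZ_apply_zero, rotZ_apply_one,
      rotZ_apply_two, Real.cos_pi_div_two, Real.sin_pi_div_two, ha2]
    ring

/-- **Spanning**: if two vorticity vectors have non-vanishing Gram determinant, a vector orthogonal to both is orthogonal to every vorticity vector.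
[folklore] -/
theorem forall_inner_curl_of_pair (hu : ContDiff ℝ 1 u) (hax : IsAxisymmetric (conjAxis R p fun z => u z - c))
    (hsw : HasNoSwirl (conjAxis R p fun z => u z - c)) {x₁ x₂ : E3}
    (hG : ‖curl u x₁‖ ^ 2 * ‖curl u x₂‖ ^ 2 - ⟪curl u x₁, curl u x₂⟫ ^ 2 ≠ 0)
    {d : E3} (h₁ : ⟪d, curl u x₁⟫ = 0) (h₂ : ⟪d, curl u x₂⟫ = 0) (x : E3) : ⟪d, curl u x⟫ = 0 := by
  set W : E3 → E3 := conjAxis R p fun z => u z - c with hW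
  have hW1 : ContDiff ℝ 1 W := contDiff_conjAxis hu R p c
  have hWcurl : ∀ y, curl W y = (R : E3 →L[ℝ] E3).det • R (curl u (R.symm y + p)) := fun y => curl_conjAxis_sub_const R p u c y
  -- in the frame all vorticity vectors are horizontal
  have hhor : ∀ x : E3, R (curl u x) 2 = 0 := by
    intro x
    have h := curl_apply_two_eq_zero hax hsw hW1 (R (x - p))
    rw [hWcurl, LinearIsometryEquiv.symm_apply_apply, sub_add_cancel, PiLp.smul_apply, smul_eq_mul] at h
    exact (mul_eq_zero.1 h).resolve_left (det_ne_zero R)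
  set a : E3 := R (curl u x₁)
  set b : E3 := R (curl u x₂)
  set w : E3 := R (curl u x)
  have hD : a 0 * b 1 - a 1 * b 0 ≠ 0 := by
    intro h0
    apply hG
    have hsq := sq_det_eq_of_horizontal (hhor x₁) (hhor x₂)
    rw [h0] at hsq
    have e1 : ‖a‖ = ‖curl u x₁‖ := LinearIsometryEquiv.norm_map R _
    have e2 : ‖b‖ = ‖curl u x₂‖ := LinearIsometryEquiv.norm_map R _
    have e3 : ⟪a, b⟫ = ⟪curl u x₁, curl u x₂⟫ := LinearIsometryEquiv.inner_map_map R _ _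
    rw [← e1, ← e2, ← e3]
    linarith [hsq]
  have h₁' : ⟪R d, a⟫ = 0 := by rwa [LinearIsometryEquiv.inner_map_map]
  have h₂' : ⟪R d, b⟫ = 0 := by rwa [LinearIsometryEquiv.inner_map_map]
  have key := inner_eq_zero_of_horizontal_span (hhor x₁) (hhor x₂) (hhor x) hD h₁' h₂'
  rwa [LinearIsometryEquiv.inner_map_map] at key

/-- **The value at the centre**: `u p − c` is a multiple of the axis direction (an axisymmetric field is vertical on its axis). [folklore] -/
theorem exists_apply_centre_sub_eq_smul (hax : IsAxisymmetric (conjAxis R p fun z => u z - c)) :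
    ∃ κ : ℝ, u p - c = κ • R.symm (EuclideanSpace.single 2 (1 : ℝ)) := by
  have h0 : cylRadius (0 : E3) = 0 := by simp [cylRadius]
  obtain ⟨h₀, h₁⟩ := hax.horizontal_eq_zero_of_cylRadius_eq_zero h0
  have hval : conjAxis R p (fun z => u z - c) 0 = R (u p - c) := by simp [conjAxis]
  rw [hval] at h₀ h₁
  set w : E3 := R (u p - c) with hw
  refine ⟨w 2, ?_⟩
  have hR : w = (w 2) • EuclideanSpace.single 2 (1 : ℝ) := by
    ext i
    fin_cases i <;> simp [h₀, h₁]
  have hback : u p - c = R.symm w := by rw [hw, R.symm_apply_apply]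
  rw [hback]
  conv_lhs => rw [hR]
  rw [map_smul]

end Static

/-! ### §3 Dynamic consequences: the frame package at one time -/

section Dynamic

variable {v : ℝ → E3 → E3} {x₀ : E3} {T : ℝ → E3 → ℝ}

/-- The conjugated solution `V s := conjAxis R x₀ (v s)` is again in the class (translation covariance of the duality class,
`IsWeaklyDivFree.comp_sub_right` / `IsMildNSSolutionBetween.comp_sub_right_zero`, and isometry covariance
`IsBoundedAncientMildSolution.conj_linearIsometryEquiv`). [folklore] -/
theorem isBoundedAncientMildSolution_conjAxis {ν : ℝ} (hB : IsBoundedAncientMildSolution ν v) (R : E3 ≃ₗᵢ[ℝ] E3) (x₀ : E3) :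
    IsBoundedAncientMildSolution ν (fun s => conjAxis R x₀ (v s)) := by
  have hB1 : IsBoundedAncientMildSolution ν (fun s y => v s (y + x₀)) := by
    have e : (fun s y => v s (y + x₀)) = fun s y => v s (y - -x₀) := by
      funext s y
      rw [sub_neg_eq_add]
    rw [e]
    obtain ⟨⟨hdiv, hmild⟩, K, hK⟩ := hB
    exact ⟨⟨fun s hs => (hdiv s hs).comp_sub_right (-x₀), fun s s' hss' hs' => (hmild s s' hss' hs').comp_sub_right_zero (-x₀)⟩,
      K, fun s hs y => hK s hs _⟩
  exact hB1.conj_linearIsometryEquiv R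

/-- The conjugated solution is jointly smooth on the slab. [folklore] -/
theorem contDiffOn_conjAxis (hsm : ContDiffOn ℝ (⊤ : ℕ∞) (uncurry v) (Iio 0 ×ˢ univ)) (R : E3 ≃ₗᵢ[ℝ] E3) (x₀ : E3) :
    ContDiffOn ℝ (⊤ : ℕ∞) (uncurry fun s => conjAxis R x₀ (v s)) (Iio 0 ×ˢ univ) := by
  have hΨ : ContDiff ℝ (⊤ : ℕ∞) (fun z : ℝ × E3 => ((z.1, R.symm z.2 + x₀) : ℝ × E3)) :=
    contDiff_fst.prodMk ((R.symm.contDiff.comp contDiff_snd).add contDiff_const)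
  have hmaps : MapsTo (fun z : ℝ × E3 => ((z.1, R.symm z.2 + x₀) : ℝ × E3)) (Iio 0 ×ˢ (univ : Set E3)) (Iio 0 ×ˢ univ) :=
    fun z hz => mk_mem_prod hz.1 (mem_univ _)
  have h1 : ContDiffOn ℝ (⊤ : ℕ∞) (uncurry v ∘ fun z : ℝ × E3 => ((z.1, R.symm z.2 + x₀) : ℝ × E3)) (Iio 0 ×ˢ univ) :=
    hsm.comp hΨ.contDiffOn hmaps
  have h2 := R.contDiff.comp_contDiffOn h1
  refine h2.congr fun z _ => ?_
  obtain ⟨s, y⟩ := z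
  rfl

/-- **THE FRAME PACKAGE (dynamic part).**  At a time `t < 0` where `v t − c` is axisymmetric swirl-free in the frame `(R, x₀)`:
(I) the time derivative of the vorticity is orthogonal to the axis direction `e = R⁻¹ e_z`, and (II) the vorticity is orthogonal to the constant `c`.
[folklore] -/
theorem frame_dynamic (hB : IsBoundedAncientMildSolution 1 v)
    (hsm : ContDiffOn ℝ (⊤ : ℕ∞) (uncurry v) (Iio 0 ×ˢ univ))
    (hlink : ∀ t < 0, ∀ x, curl (v t) x = cross (gradient (T t) x) (x - x₀))
    {t : ℝ} (ht : t < 0) {R : E3 ≃ₗᵢ[ℝ] E3} {c : E3}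
    (hax : IsAxisymmetric (conjAxis R x₀ fun z => v t z - c)) (hsw : HasNoSwirl (conjAxis R x₀ fun z => v t z - c)) :
    (∀ x, ⟪R.symm (EuclideanSpace.single 2 (1 : ℝ)), timeDerivWithin (Iio 0) (vorticity v) t x⟫ = 0) ∧
      ∀ x, ⟪c, curl (v t) x⟫ = 0 := by
  -- the conjugated solution and its vorticity formulation
  set V : ℝ → E3 → E3 := fun s => conjAxis R x₀ (v s) with hV
  have hBV : IsBoundedAncientMildSolution 1 V := isBoundedAncientMildSolution_conjAxis hB R x₀
  have hsmV : ContDiffOn ℝ (⊤ : ℕ∞) (uncurry V) (Iio 0 ×ˢ univ) := contDiffOn_conjAxis hsm R x₀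
  have hsmV' : IsSmoothSpaceTimeOn (Iio 0) V := hsmV
  have hsm' : IsSmoothSpaceTimeOn (Iio 0) v := hsm
  have hmeasV : ∀ s < 0, AEStronglyMeasurable (V s) volume := fun s hs =>
    (hsmV'.contDiff_slice hs).continuous.aestronglyMeasurable
  have hVV : IsVorticitySolutionOn (Iio 0) 1 V := Theorems.PoloidalLiouville.isVorticitySolutionOn_Iio hBV hmeasV hsmV
  -- the slice at time `t`
  set W : E3 → E3 := conjAxis R x₀ fun z => v t z - c with hW
  have hvt : ContDiff ℝ (⊤ : ℕ∞) (v t) := hsm'.contDiff_slice ht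
  have hv3 : ContDiff ℝ 3 (v t) := hvt.of_le (by norm_cast)
  have hv1 : ContDiff ℝ 1 (v t) := hvt.of_le (by norm_cast)
  have hW3 : ContDiff ℝ 3 W := contDiff_conjAxis hv3 R x₀ c
  have hW1 : ContDiff ℝ 1 W := contDiff_conjAxis hv1 R x₀ c
  have hW2 : ContDiff ℝ 2 W := hW3.of_le (by norm_num)
  have hVt : V t = fun y => W y + R c := by
    funext y
    simp [hV, hW, conjAxis, map_sub]
  -- the curl of `W` and its properties
  have hωW1 : ContDiff ℝ 1 (curl W) := contDiff_curl (n := 1) (by exact_mod_cast hW2)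
  have hωWd : Differentiable ℝ (curl W) := hωW1.differentiable one_ne_zero
  have hωz : ∀ y, curl W y 2 = 0 := fun y => curl_apply_two_eq_zero hax hsw hW1 y
  have hωperp : ∀ y, ⟪y, curl W y⟫ = 0 := fun y => inner_curl_eq_zero_of_noSwirl hax hsw hW1 y
  have hWcurl : ∀ y, curl W y = (R : E3 →L[ℝ] E3).det • R (curl (v t) (R.symm y + x₀)) :=
    fun y => curl_conjAxis_sub_const R x₀ (v t) c y
  -- the vorticity equation at time `t` in the frame: `∂ₜω_V = N(W) − Dω_W (Rc)`
  have heq : ∀ y, timeDerivWithin (Iio 0) (vorticity V) t y =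
      (convect (curl W) W y - convect W (curl W) y + (Δ (curl W)) y) - fderiv ℝ (curl W) y (R c) := by
    intro y
    have key := hVV.vorticity_eq t ht y
    rw [vorticity_apply, hVt] at key
    have hN := vortN_add_const W (R c) y
    rw [one_smul] at key
    have : timeDerivWithin (Iio 0) (vorticity V) t y =
        convect (curl fun z => W z + R c) (fun z => W z + R c) y - convect (fun z => W z + R c) (curl fun z => W z + R c) y +
          (Δ (curl fun z => W z + R c)) y := by
      rw [eq_sub_of_add_eq key]
      abel
    rw [this, hN]
  -- time derivative of the conjugated vorticity in terms of the original one
  have hωV : ∀ s, ∀ y, vorticity V s y = (R : E3 →L[ℝ] E3).det • R (vorticity v s (R.symm y + x₀)) := by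
    intro s y
    rw [vorticity_apply, vorticity_apply]
    exact curl_conjAxis R x₀ (v s) y
  have hvort : IsSmoothSpaceTimeOn (Iio 0) (vorticity v) := hsm'.isSmoothSpaceTimeOn_vorticity (uniqueDiffOn_Iio 0)
  have hΩ : ∀ y, timeDerivWithin (Iio 0) (vorticity V) t y =
      (R : E3 →L[ℝ] E3).det • R (timeDerivWithin (Iio 0) (vorticity v) t (R.symm y + x₀)) := by
    intro y
    set x : E3 := R.symm y + x₀ with hx
    have h1 : HasDerivWithinAt (fun s => vorticity v s x) (timeDerivWithin (Iio 0) (vorticity v) t x) (Iio 0) t :=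
      hvort.hasDerivWithinAt_timeDerivWithin (uniqueDiffOn_Iio 0) ht x
    set L : E3 →L[ℝ] E3 := (R : E3 →L[ℝ] E3).det • (R : E3 →L[ℝ] E3) with hL
    have hLapp : ∀ w : E3, L w = (R : E3 →L[ℝ] E3).det • R w := fun w => rfl
    have h2 : HasDerivWithinAt (L ∘ fun s => vorticity v s x) (L (timeDerivWithin (Iio 0) (vorticity v) t x)) (Iio 0) t :=
      L.hasFDerivAt.comp_hasDerivWithinAt t h1
    have hfun : (fun s => vorticity V s y) = (L ∘ fun s => vorticity v s x) := by
      funext s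
      rw [Function.comp_apply, hLapp]
      exact hωV s y
    rw [timeDerivWithin_apply, hfun, h2.derivWithin (uniqueDiffOn_Iio 0 t ht), hLapp]
  -- unthreadedness at all times: `⟪x − x₀, ∂ₜω(t,x)⟫ = 0`
  have hunthr : ∀ x, ⟪x - x₀, timeDerivWithin (Iio 0) (vorticity v) t x⟫ = 0 := by
    intro x
    have h1 : HasDerivWithinAt (fun s => vorticity v s x) (timeDerivWithin (Iio 0) (vorticity v) t x) (Iio 0) t :=
      hvort.hasDerivWithinAt_timeDerivWithin (uniqueDiffOn_Iio 0) ht x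
    have h2 : HasDerivWithinAt (fun s => ⟪x - x₀, vorticity v s x⟫)
        (⟪x - x₀, timeDerivWithin (Iio 0) (vorticity v) t x⟫) (Iio 0) t := by
      have := (hasDerivWithinAt_const t (Iio 0) (x - x₀)).inner ℝ h1
      simpa using this
    have h3 : HasDerivWithinAt (fun s => ⟪x - x₀, vorticity v s x⟫) 0 (Iio 0) t := by
      refine (hasDerivWithinAt_const t (Iio 0) (0 : ℝ)).congr_of_mem (fun s hs => ?_) ht
      rw [vorticity_apply, hlink s hs x, real_inner_comm]
      exact inner_cross_self_right' _ _
    exact (uniqueDiffOn_Iio 0 t ht).eq_deriv _ h2 h3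
  refine ⟨fun x => ?_, fun x => ?_⟩
  · -- (I): the third component of `∂ₜω_V` vanishes
    set y : E3 := R (x - x₀) with hy
    have hxy : R.symm y + x₀ = x := by rw [hy, LinearIsometryEquiv.symm_apply_apply, sub_add_cancel]
    have hN2 := (vortN_azimuthal hax hsw hW3 y).1
    have h2 : timeDerivWithin (Iio 0) (vorticity V) t y 2 = 0 := by
      rw [heq, PiLp.sub_apply, hN2, fderiv_apply_two_eq_zero hωWd hωz, sub_zero]
    rw [hΩ y, hxy, PiLp.smul_apply, smul_eq_mul] at h2
    have h3 : R (timeDerivWithin (Iio 0) (vorticity v) t x) 2 = 0 := (mul_eq_zero.1 h2).resolve_left (det_ne_zero R)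
    have h4 : ⟪R (timeDerivWithin (Iio 0) (vorticity v) t x), EuclideanSpace.single 2 (1 : ℝ)⟫ = 0 := by
      rw [EuclideanSpace.inner_single_right, h3]
      simp
    rwa [← LinearIsometryEquiv.inner_map_map R, LinearIsometryEquiv.apply_symm_apply, real_inner_comm]
  · -- (II): `⟪y, ∂ₜω_V y⟫ = ⟪Rc, ω_W y⟫` and `= 0`
    set y : E3 := R (x - x₀) with hy
    have hxy : R.symm y + x₀ = x := by rw [hy, LinearIsometryEquiv.symm_apply_apply, sub_add_cancel]
    have hNp := (vortN_azimuthal hax hsw hW3 y).2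
    have h2 : ⟪y, timeDerivWithin (Iio 0) (vorticity V) t y⟫ = ⟪R c, curl W y⟫ := by
      rw [heq, inner_sub_right, hNp, inner_fderiv_apply_eq_neg hωWd hωperp, zero_sub, neg_neg]
    have h3 : ⟪y, timeDerivWithin (Iio 0) (vorticity V) t y⟫ = 0 := by
      rw [hΩ y, hxy, inner_smul_right, hy, LinearIsometryEquiv.inner_map_map, hunthr, mul_zero]
    rw [h3, hWcurl y, hxy, inner_smul_right, LinearIsometryEquiv.inner_map_map] at h2
    -- h2 : 0 = det R * ⟪c, curl (v t) x⟫
    have := h2.symm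
    exact (mul_eq_zero.1 this).resolve_left (det_ne_zero R)

end Dynamic

end Summit.NavierStokesRegularity.NavierStokesRegularity.Theorems.PoloidalLiouville.CellFlux

end
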